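import Literature.Computability.Complexity.HardcoreInapproximabilitySecondMomentInner
import Literature.Computability.Complexity.HardcoreInapproximabilitySecondMomentTau
import Literature.Analysis.SpecialFunctions.ShiftedGaussLatticeSum2D
import HarnessLib

/-!
# The outer sum: the second-moment ratio of the reference model

For `d` perfect matchings of `n + n` vertices (no boundary), the second-moment ratio of the slice
partition function is `Σ_{g,h} A(g,h) ρ(g,h)^d` (`slyRatio0`, `slyRho`). This file assembles the
Laplace analysis: the cone bound away from the product point (`slyRate_far_le`), far terms
(`slyFarTerm_le`), near terms (`slyNearTerm_le`: the inner sums of the colours, the overlap factor,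
and the planar form in lattice coordinates `slyS_lattice`), and the explicit bound
`slyRatio0_le_explicit`: near terms summed by the two-dimensional Gaussian lattice bound
(`Literature.Analysis.SpecialFunctions.ShiftedGaussLatticeSum2D`), far terms by the cone bound, with
main constant `e^{Pref_A/2}(e^{Pref_B/2}κ₃^{-1/2})^d/√(AC-B²) = τ` (`…SecondMomentTau`).

## References
* [MosselWeitzWormald2008] E. Mossel, D. Weitz, N. Wormald, PTRF 143 (2009), §5, Theorem 6.11.
* [Sly2010] A. Sly, FOCS 2010 / arXiv:1005.5584, Lemma 3.5 and §3.3.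
-/

namespace Literature.Computability.Complexity

open Real Finset Literature.Analysis.SpecialFunctions

section Defs

/-- **The colour factor** `ρ(g,h) = B₀(g,h) Σ_e t(e)` of one matching. [cite: Sly2010, proof of Lemma 3.5] -/
noncomputable def slyRho (N a b g h : ℕ) : ℝ :=
  ∑ e ∈ range (a - g + 1), slyB0 N a b g h * slyT N a b g h e

/-- **The second-moment ratio of the reference model** (`d` matchings of `n + n` vertices, no
boundary): `E[Z_{a,b}²]/(E Z_{a,b})² = Σ_{g,h} A(g,h) ρ(g,h)^d`.
[cite: MosselWeitzWormald2008, §5 and proof of Theorem 6.11; Sly2010, Lemma 3.5] -/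
noncomputable def slyRatio0 (n d a b : ℕ) : ℝ :=
  ∑ g ∈ range (a + 1), ∑ h ∈ range (b + 1), slyAcoef n a b g h * slyRho n a b g h ^ d

end Defs

section FarCone

variable {α β : ℝ}

set_option maxHeartbeats 1600000 in
/-- **The rate away from the product point** (from `-H_d ≻ κ`, Taylor and the gap): for `c` in the
polytope with `ι = dist(c, c*) ≥ ι₀ > 0`, `f_d(c) ≤ -min(η, (κ/2) ι₀²)`. [cite: Sly2010, §3.3] -/
theorem slyRate_far_le (d : ℕ) (hα : 0 < α) (hβ : 0 < β) (hαβ : α + β < 1) {m : ℝ}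
    (hm : m = min (min α β) (1 - α - β)) {κ η r₀ ι₀ : ℝ} (hκ : 0 < κ) (hι₀ : 0 < ι₀)
    (hPD : ∀ h₁ h₂ h₃ : ℝ, slyQ d α β h₁ h₂ h₃ ≤ -κ * (h₁ ^ 2 + h₂ ^ 2 + h₃ ^ 2))
    (hgap : ∀ c ∈ slyPolytope α β, r₀ ≤ dist c (slyCstar α β) →
      slyRate d α β c.1 c.2.1 c.2.2 ≤ -η)
    (hr₀ : 3 * r₀ ≤ m ^ 2 / 2) (hr₀κ : 12 * (4 + 7 * (d : ℝ)) * (27 * r₀) ≤ κ / 2 * m ^ 4)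
    (hηι : κ / 2 * ι₀ ^ 2 ≤ η)
    {γ δ ε : ℝ} (hc : ((γ, δ, ε) : ℝ × ℝ × ℝ) ∈ slyPolytope α β)
    (hfar : ι₀ ≤ dist ((γ, δ, ε) : ℝ × ℝ × ℝ) (slyCstar α β)) :
    slyRate d α β γ δ ε ≤ -(κ / 2) * ι₀ ^ 2 := by
  set h₁ := γ - α ^ 2 with hh₁
  set h₂ := δ - β ^ 2 with hh₂
  set h₃ := ε - α * (1 - α - β) with hh₃
  have hm0 : 0 < m := by rw [hm]; exact lt_min (lt_min hα hβ) (by linarith)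
  have eγ : γ = α ^ 2 + h₁ := by rw [hh₁]; ring
  have eδ : δ = β ^ 2 + h₂ := by rw [hh₂]; ring
  have eε : ε = α * (1 - α - β) + h₃ := by rw [hh₃]; ring
  have hdist : dist ((γ, δ, ε) : ℝ × ℝ × ℝ) (slyCstar α β) = max |h₁| (max |h₂| |h₃|) := by
    rw [slyCstar, Prod.dist_eq, Prod.dist_eq, Real.dist_eq, Real.dist_eq, Real.dist_eq]
  by_cases hnear : dist ((γ, δ, ε) : ℝ × ℝ × ℝ) (slyCstar α β) < r₀
  · rw [hdist] at hnear hfar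
    set ι := max |h₁| (max |h₂| |h₃|) with hι
    have a1 : |h₁| ≤ ι := le_max_left _ _
    have a2 : |h₂| ≤ ι := le_trans (le_max_left _ _) (le_max_right _ _)
    have a3 : |h₃| ≤ ι := le_trans (le_max_right _ _) (le_max_right _ _)
    have hs : |h₁| + |h₂| + |h₃| ≤ m ^ 2 / 2 := by linarith
    have Td := abs_slyRate_sub_slyQ_le d hα hβ hαβ hm rfl hs
    rw [abs_le, ← eγ, ← eδ, ← eε] at Td
    have hPDh := hPD h₁ h₂ h₃
    -- `‖h‖² ≥ ι²` and `s³ ≤ 27 ι³ ≤ 27 r₀ ι²`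
    have hsq : ι ^ 2 ≤ h₁ ^ 2 + h₂ ^ 2 + h₃ ^ 2 := by
      have e : ι = |h₁| ∨ ι = |h₂| ∨ ι = |h₃| := by
        rcases le_total |h₁| (max |h₂| |h₃|) with h | h
        · rcases le_total |h₂| |h₃| with h' | h'
          · right; right; rw [hι, max_eq_right h, max_eq_right h']
          · right; left; rw [hι, max_eq_right h, max_eq_left h']
        · left; rw [hι, max_eq_left h]
      rcases e with e | e | e <;> rw [e, sq_abs] <;> nlinarith [sq_nonneg h₁, sq_nonneg h₂, sq_nonneg h₃]
    have hcube : (|h₁| + |h₂| + |h₃|) ^ 3 ≤ 27 * r₀ * ι ^ 2 := by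
      have hle : |h₁| + |h₂| + |h₃| ≤ 3 * ι := by linarith
      have hι0 : 0 ≤ ι := le_trans (abs_nonneg _) a1
      calc (|h₁| + |h₂| + |h₃|) ^ 3 ≤ (3 * ι) ^ 3 := pow_le_pow_left₀ (by positivity) hle 3
        _ = 27 * ι * ι ^ 2 := by ring
        _ ≤ 27 * r₀ * ι ^ 2 := by
            apply mul_le_mul_of_nonneg_right _ (by positivity)
            nlinarith
    have hrem : 12 * (4 + 7 * (d : ℝ)) * ((|h₁| + |h₂| + |h₃|) ^ 3 / m ^ 4) ≤ κ / 2 * ι ^ 2 := by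
      have hm4 : 0 < m ^ 4 := by positivity
      calc 12 * (4 + 7 * (d : ℝ)) * ((|h₁| + |h₂| + |h₃|) ^ 3 / m ^ 4)
          ≤ 12 * (4 + 7 * (d : ℝ)) * (27 * r₀ * ι ^ 2 / m ^ 4) := by
            apply mul_le_mul_of_nonneg_left _ (by positivity)
            exact div_le_div_of_nonneg_right hcube hm4.le
        _ = (12 * (4 + 7 * (d : ℝ)) * (27 * r₀)) * ι ^ 2 / m ^ 4 := by ring
        _ ≤ (κ / 2 * m ^ 4) * ι ^ 2 / m ^ 4 := by
            apply div_le_div_of_nonneg_right _ hm4.le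
            exact mul_le_mul_of_nonneg_right hr₀κ (by positivity)
        _ = κ / 2 * ι ^ 2 := by field_simp
    have hPD' : slyQ d α β h₁ h₂ h₃ + κ * ι ^ 2 ≤ 0 := by
      have e : -κ * (h₁ ^ 2 + h₂ ^ 2 + h₃ ^ 2) = -(κ * (h₁ ^ 2 + h₂ ^ 2 + h₃ ^ 2)) := by ring
      rw [e] at hPDh
      nlinarith [mul_le_mul_of_nonneg_left hsq hκ.le]
    have hιι : κ / 2 * ι₀ ^ 2 ≤ κ / 2 * ι ^ 2 := by
      apply mul_le_mul_of_nonneg_left _ (by positivity)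
      exact pow_le_pow_left₀ hι₀.le hfar 2
    linarith [Td.2]
  · push Not at hnear
    have := hgap _ hc hnear
    simp only at this
    linarith

end FarCone

section FarTerm

variable {n a b g h : ℕ}

set_option maxHeartbeats 1600000 in
/-- **A far term of the outer sum**: if every non-degenerate inner term of the colour has rate at most
`-ζ - f_A(g,h)` (in `d`-units: `d G ≤ -ζ - f_A`... precisely `n d G(c_e) ≤ -n ζ - n f_A`), then
`A(g,h) ρ(g,h)^d ≤ (n+1)^d exp((5d+2)(log n/2 + 2) - n ζ)`. [cite: Sly2010, §3.3 (e:gtEZ2-type bounds)] -/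
theorem slyFarTerm_le (d : ℕ) (hd : 1 ≤ d) (hn : 1 ≤ n) (hga : g ≤ a) (hhb : h ≤ b)
    (hbN : b + b - h ≤ n) (habN : a + b < n) {ζ : ℝ}
    (hG : ∀ e : ℕ, e ≤ a - g → slyB0 n a b g h * slyT n a b g h e ≠ 0 →
      (d : ℝ) * slyGrate ((a : ℝ) / n) ((b : ℝ) / n) ((g : ℝ) / n) ((h : ℝ) / n) ((e : ℝ) / n) ≤
        -ζ - slyFA ((a : ℝ) / n) ((b : ℝ) / n) ((g : ℝ) / n) ((h : ℝ) / n)) :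
    slyAcoef n a b g h * slyRho n a b g h ^ d ≤
      ((n : ℝ) + 1) ^ d * Real.exp ((5 * d + 2) * (Real.log n / 2 + 2) - n * ζ) := by
  have hnR : (0 : ℝ) < n := by exact_mod_cast hn
  have hdR : (0 : ℝ) < d := by exact_mod_cast hd
  set fA := slyFA ((a : ℝ) / n) ((b : ℝ) / n) ((g : ℝ) / n) ((h : ℝ) / n) with hfA
  set L := Real.log n / 2 + 2 with hL
  -- each inner term
  have hterm : ∀ e ∈ range (a - g + 1), slyB0 n a b g h * slyT n a b g h e ≤
      Real.exp (n * ((-ζ - fA) / d) + 5 * L) := by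
    intro e he
    rw [mem_range, Nat.lt_succ_iff] at he
    by_cases h0 : slyB0 n a b g h * slyT n a b g h e = 0
    · rw [h0]; exact (Real.exp_pos _).le
    refine le_trans (slyB0_mul_slyT_le hn hga hhb hbN habN he) ?_
    rw [Real.exp_le_exp]
    have := hG e he h0
    have hGle : slyGrate ((a : ℝ) / n) ((b : ℝ) / n) ((g : ℝ) / n) ((h : ℝ) / n) ((e : ℝ) / n) ≤
        (-ζ - fA) / d := by
      rw [le_div_iff₀ hdR]; linarith
    nlinarith [mul_le_mul_of_nonneg_left hGle hnR.le]
  have hρ : slyRho n a b g h ≤ ((n : ℝ) + 1) * Real.exp (n * ((-ζ - fA) / d) + 5 * L) := by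
    unfold slyRho
    refine le_trans (sum_le_sum hterm) ?_
    rw [sum_const, card_range, nsmul_eq_mul]
    apply mul_le_mul_of_nonneg_right _ (Real.exp_pos _).le
    have : ((a - g + 1 : ℕ) : ℝ) ≤ n + 1 := by
      have : a - g + 1 ≤ n + 1 := by omega
      exact_mod_cast this
    exact this
  have hρ0 : 0 ≤ slyRho n a b g h := by
    unfold slyRho; exact sum_nonneg fun e _ => by unfold slyB0 slyT; positivity
  have hA := slyAcoef_le hn hga hhb (by omega) (by omega)
  rw [← hfA, ← hL] at hA
  have hA0 : 0 ≤ slyAcoef n a b g h := by unfold slyAcoef; positivity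
  calc slyAcoef n a b g h * slyRho n a b g h ^ d
      ≤ Real.exp (n * fA + 2 * L) * (((n : ℝ) + 1) * Real.exp (n * ((-ζ - fA) / d) + 5 * L)) ^ d := by
        apply mul_le_mul hA (pow_le_pow_left₀ hρ0 hρ d) (by positivity) (Real.exp_pos _).le
    _ = ((n : ℝ) + 1) ^ d * (Real.exp (n * fA + 2 * L) * Real.exp (n * ((-ζ - fA) / d) + 5 * L) ^ d) := by
        rw [mul_pow]; ring
    _ = ((n : ℝ) + 1) ^ d * Real.exp ((5 * d + 2) * L - n * ζ) := by
        congr 1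
        rw [← Real.exp_nat_mul, ← Real.exp_add]
        congr 1
        field_simp
        ring

end FarTerm

section NearTerm

variable {α β : ℝ}

/-- `f₀ = f_A`. [folklore] -/
theorem slyRate_zero_eq_slyFA (α β γ δ ε : ℝ) : slyRate 0 α β γ δ ε = slyFA α β γ δ := by
  unfold slyRate; simp

/-- The lattice form of `n · S(h₁,h₂)`. [folklore] -/
theorem slyS_lattice {n : ℕ} (hn : 0 < n) (A B C α β : ℝ) (g h : ℕ) :
    (n : ℝ) * (-(A * ((g : ℝ) / n - α ^ 2) ^ 2 + 2 * B * ((g : ℝ) / n - α ^ 2) * ((h : ℝ) / n - β ^ 2) +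
        C * ((h : ℝ) / n - β ^ 2) ^ 2) / 2) =
      -((A * ((g : ℝ) - n * α ^ 2) ^ 2 + 2 * B * ((g : ℝ) - n * α ^ 2) * ((h : ℝ) - n * β ^ 2) +
        C * ((h : ℝ) - n * β ^ 2) ^ 2) / (2 * n)) := by
  have hnR : (n : ℝ) ≠ 0 := by exact_mod_cast hn.ne'
  field_simp

/-- If `g` exceeds the free minus class then the colour factor vanishes. [folklore] -/
theorem slyRho_eq_zero_of_lt {N a b g h : ℕ} (hgF : N - (b + b - h) < g) : slyRho N a b g h = 0 := by
  unfold slyRho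
  refine sum_eq_zero fun e _ => ?_
  have : ((N - (b + b - h)).choose g : ℝ) = 0 := by exact_mod_cast Nat.choose_eq_zero_of_lt hgF
  unfold slyB0; rw [this]; ring

set_option maxHeartbeats 3200000 in
/-- **A near term of the outer sum**: for `(g,h)` within `c₀ w` of `(α², β²)n` (in density),
`A(g,h) ρ(g,h)^d ≤ e^{n S(h₁,h₂)} · (2πn)⁻¹ e^{Pref_A(c*)/2} (e^{Pref_B(c*)/2} κ₃^{-1/2})^d · e^{θ_A} (1+θ)^d`.
[cite: MosselWeitzWormald2008, proof of Theorem 6.11; Sly2010, proof of Lemma 3.5] -/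
theorem slyNearTerm_le (d : ℕ) (hd : 1 ≤ d) {n a b g h μ : ℕ} {m κ η r₀ w c₀ : ℝ}
    (hn : 1 ≤ n) (hga : g ≤ a) (hhb : h ≤ b) (hbN : b + b - h ≤ n) (habN : a + b < n)
    (hα : (a : ℝ) = n * α) (hβ : (b : ℝ) = n * β) (hα0 : 0 < α) (hβ0 : 0 < β) (hαβ : α + β < 1)
    (hm : m = min (min α β) (1 - α - β)) (hκ : 0 < κ) (hw : 0 < w) (hc₀1 : c₀ ≤ 1)
    (hPD : ∀ h₁ h₂ h₃ : ℝ, slyQ d α β h₁ h₂ h₃ ≤ -κ * (h₁ ^ 2 + h₂ ^ 2 + h₃ ^ 2))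
    (hgap : ∀ c ∈ slyPolytope α β, r₀ ≤ dist c (slyCstar α β) →
      slyRate d α β c.1 c.2.1 c.2.2 ≤ -η)
    (hr₀ : 3 * r₀ ≤ m ^ 2 / 2) (hr₀κ : 12 * (4 + 7 * (d : ℝ)) * (8 * r₀) ≤ κ / 4 * m ^ 4)
    (hQ : 3 * ((d : ℝ) + 2) / m ^ 5 * c₀ ^ 2 ≤ κ / 8) (hcube : 48 * c₀ ^ 3 * w ≤ κ / 8 * m ^ 4)
    (hηw : κ * w ^ 2 ≤ η) (hw2 : 2 * w ≤ m ^ 2 / 4) (hμ1 : 1 ≤ μ) (hμ : (μ : ℝ) ≤ n * (m ^ 2 / 2))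
    (hnear : |(g : ℝ) / n - α ^ 2| + |(h : ℝ) / n - β ^ 2| ≤ c₀ * w) :
    slyAcoef n a b g h * slyRho n a b g h ^ d ≤
      Real.exp (-((slySA d α β * ((g : ℝ) - n * α ^ 2) ^ 2 +
          2 * slySB d α β * ((g : ℝ) - n * α ^ 2) * ((h : ℝ) - n * β ^ 2) +
          slySC d α β * ((h : ℝ) - n * β ^ 2) ^ 2) / (2 * n))) *
        ((2 * π * n)⁻¹ * Real.exp (slyPrefA α β (α ^ 2) (β ^ 2) / 2) *
          (Real.exp (slyPrefB α β (α ^ 2) (β ^ 2) (α * (1 - α - β)) / 2) / Real.sqrt (slyK3 α β)) ^ d) *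
        (Real.exp (48 * n * (c₀ * w) ^ 3 / m ^ 4 + 8 * (c₀ * w) / (m ^ 2 / 2) / 2 + 2 / (μ : ℝ)) *
          (Real.exp (180 * n * (2 * w) ^ 3 / m ^ 4 + 19 * (2 * w) / (2 * (m ^ 2 / 2)) + 11 / (6 * (μ : ℝ))) *
              (1 + 2 / (rexp (π ^ 2 / (slyK3 α β / (2 * n))) - 1)) +
            ((n : ℝ) + 1) * Real.exp (-(n * κ * w ^ 2 / (2 * d)) + 5 * (Real.log n / 2 + 2)) /
              (Real.exp (slyPrefB α β (α ^ 2) (β ^ 2) (α * (1 - α - β)) / 2) / Real.sqrt (slyK3 α β))) ^ d) := by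
  -- notation and basic facts
  have hn0 : 0 < n := hn
  have hnR : (0 : ℝ) < n := by exact_mod_cast hn0
  have hdR : (0 : ℝ) < d := by exact_mod_cast hd
  have hm0 : 0 < m := by rw [hm]; exact lt_min (lt_min hα0 hβ0) (by linarith)
  have hκ3 := slyK3_pos hα0 hβ0 hαβ
  set KB : ℝ := Real.exp (slyPrefB α β (α ^ 2) (β ^ 2) (α * (1 - α - β)) / 2) / Real.sqrt (slyK3 α β)
    with hKB
  have hKB0 : 0 < KB := by rw [hKB]; exact div_pos (Real.exp_pos _) (Real.sqrt_pos.mpr hκ3)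
  set τ₃ : ℝ := 1 + 2 / (rexp (π ^ 2 / (slyK3 α β / (2 * n))) - 1) with hτ₃
  have hτ₃1 : 1 ≤ τ₃ := one_le_thetaFactor (by positivity)
  -- the degenerate case `g > F₀`
  by_cases hgF : g ≤ n - (b + b - h)
  swap
  · rw [slyRho_eq_zero_of_lt (not_le.mp hgF), zero_pow (by omega), mul_zero]
    have : 0 ≤ Real.exp (180 * n * (2 * w) ^ 3 / m ^ 4 + 19 * (2 * w) / (2 * (m ^ 2 / 2)) +
        11 / (6 * (μ : ℝ))) * τ₃ + ((n : ℝ) + 1) * Real.exp (-(n * κ * w ^ 2 / (2 * d)) +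
        5 * (Real.log n / 2 + 2)) / KB := by positivity
    positivity
  set γ : ℝ := (g : ℝ) / n with hγ
  set δ : ℝ := (h : ℝ) / n with hδ
  set h₁ : ℝ := γ - α ^ 2 with hh₁
  set h₂ : ℝ := δ - β ^ 2 with hh₂
  set εs : ℝ := α * (1 - α - β) with hεs
  set sgh : ℝ := |h₁| + |h₂| with hsgh
  have hs0 : 0 ≤ sgh := by positivity
  have hsw : sgh ≤ c₀ * w := hnear
  have hcw : c₀ * w ≤ w := by nlinarith
  have eα : (a : ℝ) / n = α := by rw [hα]; field_simp
  have eβ : (b : ℝ) / n = β := by rw [hβ]; field_simp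
  set m₀ : ℝ := m ^ 2 / 2 with hm₀
  have hm₀0 : 0 < m₀ := by positivity
  have hcwm : c₀ * w ≤ m ^ 2 / 2 := by linarith
  -- cells at `c*` and near
  have Hc0 := slyCells_cstar_ge hα0 hβ0 hαβ hm
  have hcell0 : ∀ u ∈ slyCells α β (α ^ 2) (β ^ 2) εs, m₀ ≤ u := fun u hu => by
    have := Hc0 u hu; rw [hm₀]; nlinarith [sq_nonneg m]
  have hcell : ∀ e : ℕ, e ≤ a - g → |(e : ℝ) / n - εs| ≤ w →
      ∀ u ∈ slyCells α β γ δ ((e : ℝ) / n), m₀ ≤ u := by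
    intro e _ hew
    apply slyCells_near_ge hα0 hβ0 hαβ hm
    rw [← hh₁, ← hh₂]; linarith
  -- the interior conditions from the cells
  have hint : ∀ e : ℕ, e ≤ a - g → |(e : ℝ) / n - εs| ≤ w →
      (μ ≤ g ∧ g + μ ≤ n - (b + b - h)) ∧ (μ ≤ e ∧ e + μ ≤ n - (b + b - h) - g) ∧
      (μ ≤ a - g - e ∧ a - g - e + μ ≤ b - h) ∧ (μ ≤ a - g ∧ a - g + μ ≤ n - b - g - e) ∧
      (μ ≤ a ∧ a - g + μ ≤ n - a ∧ a + μ ≤ n - b) := by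
    intro e he hew
    have hc := hcell e he hew
    rw [hγ, hδ, ← eα, ← eβ] at hc
    exact slyInterior_of_cells hn0 hhb hbN hμ hc
  -- the far gap
  have hfar : ∀ e : ℕ, e ≤ a - g → w < |(e : ℝ) / n - εs| → slyT n a b g h e ≠ 0 →
      n * slyGrate α β γ δ ((e : ℝ) / n) ≤ n * slyMB α β h₁ h₂ - n * κ * w ^ 2 / (2 * d) := by
    intro e he hew ht
    have hpoly := mem_slyPolytope_of_slyT_ne_zero hn0 hga hhb hbN hgF he ht
    rw [eα, eβ] at hpoly
    have hfg := slyFar_gap d hα0 hβ0 hαβ hm hκ hw hc₀1 hPD hgap hr₀ hr₀κ hcwm hQ hcube hηw hpoly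
      (by rw [← hγ, ← hδ, ← hh₁, ← hh₂]; exact hsw) hew
    rw [← hγ, ← hδ, ← hh₁, ← hh₂] at hfg
    have h1 : slyGrate α β γ δ ((e : ℝ) / n) - slyMB α β h₁ h₂ ≤ -(κ / 2 * w ^ 2) / d := by
      rw [le_div_iff₀ hdR]; linarith
    have h2 := mul_le_mul_of_nonneg_left h1 hnR.le
    have e1 : (n : ℝ) * (-(κ / 2 * w ^ 2) / d) = -(n * κ * w ^ 2 / (2 * d)) := by
      field_simp
    linarith
  -- the inner sum
  have hwin : |(g : ℝ) / n - α ^ 2| + |(h : ℝ) / n - β ^ 2| + w ≤ (min (min α β) (1 - α - β)) ^ 2 / 2 := by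
    rw [← hm, ← hγ, ← hδ, ← hh₁, ← hh₂]; linarith
  have hInner := slyInner_sum_le hn hga hhb hbN habN hα hβ hα0 hβ0 hαβ hw.le hwin hμ1 hint hm₀0
    hcell0 hcell hfar
  rw [← hγ, ← hδ, ← hh₁, ← hh₂, ← hεs, ← hm] at hInner
  -- monotone bound of the error exponent: `σ = sgh + w ≤ 2w`
  have hσ2 : |h₁| + |h₂| + w ≤ 2 * w := by linarith
  have hE₁ : 180 * n * (|h₁| + |h₂| + w) ^ 3 / m ^ 4 + 19 * (|h₁| + |h₂| + w) / (2 * m₀) +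
      11 / (6 * (μ : ℝ)) ≤
      180 * n * (2 * w) ^ 3 / m ^ 4 + 19 * (2 * w) / (2 * (m ^ 2 / 2)) + 11 / (6 * (μ : ℝ)) := by
    have hσ0 : 0 ≤ |h₁| + |h₂| + w := by positivity
    have c1 : (|h₁| + |h₂| + w) ^ 3 ≤ (2 * w) ^ 3 := pow_le_pow_left₀ hσ0 hσ2 3
    have t1 : 180 * n * (|h₁| + |h₂| + w) ^ 3 / m ^ 4 ≤ 180 * n * (2 * w) ^ 3 / m ^ 4 := by
      apply div_le_div_of_nonneg_right _ (by positivity)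
      exact mul_le_mul_of_nonneg_left c1 (by positivity)
    have t2 : 19 * (|h₁| + |h₂| + w) / (2 * m₀) ≤ 19 * (2 * w) / (2 * (m ^ 2 / 2)) := by
      rw [hm₀]; apply div_le_div_of_nonneg_right _ (by positivity); linarith
    linarith
  -- `ρ ≤ e^{n M_B} · KB · (1 + θ)`
  set MB := slyMB α β h₁ h₂ with hMB
  set Θ : ℝ := Real.exp (180 * n * (2 * w) ^ 3 / m ^ 4 + 19 * (2 * w) / (2 * (m ^ 2 / 2)) +
      11 / (6 * (μ : ℝ))) * τ₃ +
    ((n : ℝ) + 1) * Real.exp (-(n * κ * w ^ 2 / (2 * d)) + 5 * (Real.log n / 2 + 2)) / KB with hΘ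
  have hρ : slyRho n a b g h ≤ Real.exp (n * MB) * KB * Θ := by
    unfold slyRho
    refine le_trans hInner ?_
    have e1 : Real.exp (n * MB + slyPrefB α β (α ^ 2) (β ^ 2) εs / 2 +
        (180 * n * (|h₁| + |h₂| + w) ^ 3 / m ^ 4 + 19 * (|h₁| + |h₂| + w) / (2 * m₀) +
          11 / (6 * (μ : ℝ)))) * (1 / Real.sqrt (slyK3 α β)) * τ₃ =
        Real.exp (n * MB) * KB * (Real.exp (180 * n * (|h₁| + |h₂| + w) ^ 3 / m ^ 4 +
          19 * (|h₁| + |h₂| + w) / (2 * m₀) + 11 / (6 * (μ : ℝ))) * τ₃) := by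
      rw [hKB, Real.exp_add, Real.exp_add]; ring
    have e2 : ((a - g + 1 : ℕ) : ℝ) * Real.exp (n * MB - n * κ * w ^ 2 / (2 * d) +
        5 * (Real.log n / 2 + 2)) = Real.exp (n * MB) * KB *
        (((a - g + 1 : ℕ) : ℝ) * Real.exp (-(n * κ * w ^ 2 / (2 * d)) + 5 * (Real.log n / 2 + 2)) / KB) := by
      rw [show (n : ℝ) * MB - n * κ * w ^ 2 / (2 * d) + 5 * (Real.log n / 2 + 2) =
        n * MB + (-(n * κ * w ^ 2 / (2 * d)) + 5 * (Real.log n / 2 + 2)) by ring, Real.exp_add]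
      field_simp
    rw [e1, e2, ← mul_add]
    apply mul_le_mul_of_nonneg_left _ (by positivity)
    rw [hΘ]
    apply add_le_add
    · exact mul_le_mul_of_nonneg_right (Real.exp_le_exp.mpr hE₁) (by linarith)
    · apply div_le_div_of_nonneg_right _ hKB0.le
      apply mul_le_mul_of_nonneg_right _ (Real.exp_pos _).le
      have : a - g + 1 ≤ n + 1 := by omega
      exact_mod_cast this
  have hρ0 : 0 ≤ slyRho n a b g h := by
    unfold slyRho; exact sum_nonneg fun e _ => by unfold slyB0 slyT; positivity
  -- the overlap factor
  have HA0 := slyCellsA_cstar_ge hα0 hβ0 hαβ hm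
  have hcA0 : ∀ u ∈ slyCellsA α β (α ^ 2) (β ^ 2), m₀ ≤ u := fun u hu => by
    have := HA0 u hu; rw [hm₀]; nlinarith [sq_nonneg m]
  have hcA : ∀ u ∈ slyCellsA α β γ δ, m₀ ≤ u := by
    apply slyCellsA_near_ge hα0 hβ0 hαβ hm
    rw [← hh₁, ← hh₂]; linarith
  have hintA := slyInteriorA_of_cells (a := a) (b := b) (g := g) (h := h) hn0 hμ
    (by rw [eα, eβ]; exact hcA)
  obtain ⟨⟨kA1, kA1', kA2'⟩, ⟨kA3, kA3', kA4'⟩⟩ := hintA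
  have hAint := log_slyAcoef_interior hga hhb (by omega) (by omega) hμ1 kA1 kA1' kA2' kA3 kA3' kA4'
  rw [eα, eβ, ← hγ, ← hδ, abs_le] at hAint
  -- Taylor for `f_A` and the prefactor
  have hs12 : |h₁| + |h₂| + |(0:ℝ)| ≤ m ^ 2 / 2 := by rw [abs_zero, add_zero]; linarith
  have T0 := abs_slyRate_sub_slyQ_le 0 hα0 hβ0 hαβ hm rfl hs12
  rw [abs_zero, add_zero, abs_le] at T0
  push_cast at T0
  norm_num at T0
  have hfA : slyFA α β γ δ = slyRate 0 α β (α ^ 2 + h₁) (β ^ 2 + h₂) (α * (1 - α - β) + 0) := by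
    rw [slyRate_zero_eq_slyFA, hh₁, hh₂]; ring_nf
  rw [add_zero] at hfA
  have hPA := abs_slyPrefA_sub_le (α := α) (β := β) hm₀0 hcA hcA0
  rw [abs_le, ← hh₁, ← hh₂] at hPA
  have hcube0 : 48 * ((|h₁| + |h₂|) ^ 3 / m ^ 4) ≤ 48 * (c₀ * w) ^ 3 / m ^ 4 := by
    rw [mul_div_assoc]
    apply mul_le_mul_of_nonneg_left _ (by norm_num)
    apply div_le_div_of_nonneg_right _ (by positivity)
    exact pow_le_pow_left₀ hs0 hsw 3
  have hlogA : Real.log (slyAcoef n a b g h) ≤ n * slyQ 0 α β h₁ h₂ 0 +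
      (48 * n * (c₀ * w) ^ 3 / m ^ 4 + 8 * (c₀ * w) / (m ^ 2 / 2) / 2 + 2 / (μ : ℝ)) +
      slyPrefA α β (α ^ 2) (β ^ 2) / 2 - Real.log (2 * π * n) := by
    have h1 : slyFA α β γ δ ≤ slyQ 0 α β h₁ h₂ 0 + 48 * ((|h₁| + |h₂|) ^ 3 / m ^ 4) := by
      rw [hfA]; linarith [T0.2]
    have h2 := mul_le_mul_of_nonneg_left h1 hnR.le
    have h3 : (8:ℝ) * ((|h₁| + |h₂|) / m₀) ≤ 8 * (c₀ * w) / (m ^ 2 / 2) := by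
      rw [hm₀, mul_div_assoc]
      exact mul_le_mul_of_nonneg_left (div_le_div_of_nonneg_right hsw (by positivity)) (by norm_num)
    have h4 := mul_le_mul_of_nonneg_left hcube0 hnR.le
    have e5 : (n : ℝ) * (slyQ 0 α β h₁ h₂ 0 + 48 * ((|h₁| + |h₂|) ^ 3 / m ^ 4)) =
        n * slyQ 0 α β h₁ h₂ 0 + n * (48 * ((|h₁| + |h₂|) ^ 3 / m ^ 4)) := by ring
    have e6 : (n : ℝ) * (48 * (c₀ * w) ^ 3 / m ^ 4) = 48 * n * (c₀ * w) ^ 3 / m ^ 4 := by ring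
    linarith [hAint.2, hPA.2]
  have hA0 : 0 ≤ slyAcoef n a b g h := by unfold slyAcoef; positivity
  have hAexp : slyAcoef n a b g h ≤ Real.exp (n * slyQ 0 α β h₁ h₂ 0) *
      ((2 * π * n)⁻¹ * Real.exp (slyPrefA α β (α ^ 2) (β ^ 2) / 2)) *
      Real.exp (48 * n * (c₀ * w) ^ 3 / m ^ 4 + 8 * (c₀ * w) / (m ^ 2 / 2) / 2 + 2 / (μ : ℝ)) := by
    refine le_trans (le_exp_log_of_nonneg hA0) ?_
    have : Real.exp (Real.log (slyAcoef n a b g h)) ≤ Real.exp (n * slyQ 0 α β h₁ h₂ 0 +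
        (48 * n * (c₀ * w) ^ 3 / m ^ 4 + 8 * (c₀ * w) / (m ^ 2 / 2) / 2 + 2 / (μ : ℝ)) +
        slyPrefA α β (α ^ 2) (β ^ 2) / 2 - Real.log (2 * π * n)) := Real.exp_le_exp.mpr hlogA
    refine le_trans this (le_of_eq ?_)
    rw [Real.exp_sub, Real.exp_add, Real.exp_add, Real.exp_log (by positivity)]
    field_simp
  -- combine
  have hρd : slyRho n a b g h ^ d ≤ (Real.exp (n * MB) * KB * Θ) ^ d := pow_le_pow_left₀ hρ0 hρ d
  have hS := slyS_eq (d := d) hα0 hβ0 hαβ h₁ h₂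
  have hlat := slyS_lattice hn0 (slySA d α β) (slySB d α β) (slySC d α β) α β g h
  rw [← hγ, ← hδ, ← hh₁, ← hh₂] at hlat
  calc slyAcoef n a b g h * slyRho n a b g h ^ d
      ≤ (Real.exp (n * slyQ 0 α β h₁ h₂ 0) *
          ((2 * π * n)⁻¹ * Real.exp (slyPrefA α β (α ^ 2) (β ^ 2) / 2)) *
          Real.exp (48 * n * (c₀ * w) ^ 3 / m ^ 4 + 8 * (c₀ * w) / (m ^ 2 / 2) / 2 + 2 / (μ : ℝ))) *
        (Real.exp (n * MB) * KB * Θ) ^ d :=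
        mul_le_mul hAexp hρd (by positivity) (by positivity)
    _ = (Real.exp (n * slyQ 0 α β h₁ h₂ 0) * Real.exp (d * (n * MB))) *
        ((2 * π * n)⁻¹ * Real.exp (slyPrefA α β (α ^ 2) (β ^ 2) / 2) * KB ^ d) *
        (Real.exp (48 * n * (c₀ * w) ^ 3 / m ^ 4 + 8 * (c₀ * w) / (m ^ 2 / 2) / 2 + 2 / (μ : ℝ)) *
          Θ ^ d) := by
        rw [mul_pow (Real.exp (n * MB) * KB) Θ d, mul_pow (Real.exp (n * MB)) KB d,
          ← Real.exp_nat_mul]; ring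
    _ = _ := by
        rw [← Real.exp_add,
          show (n : ℝ) * slyQ 0 α β h₁ h₂ 0 + d * (n * MB) = n * (slyQ 0 α β h₁ h₂ 0 + d * MB) by ring,
          hMB, hS, hlat]

end NearTerm

section Explicit

variable {α β : ℝ}

set_option maxHeartbeats 3200000 in
/-- **The second-moment ratio of the reference model, explicit form**: near terms summed by the
two-dimensional Gaussian lattice bound, far terms by the cone bound.
[cite: MosselWeitzWormald2008, proof of Theorem 6.11; Sly2010, Lemma 3.5 and §3.3] -/
theorem slyRatio0_le_explicit (d : ℕ) (hd : 1 ≤ d) {n a b μ : ℕ} {m κ η r₀ w c₀ : ℝ}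
    (hn : 1 ≤ n) (hb2 : b + b ≤ n) (habN : a + b < n)
    (hα : (a : ℝ) = n * α) (hβ : (b : ℝ) = n * β) (hα0 : 0 < α) (hβ0 : 0 < β) (hαβ : α + β < 1)
    (hm : m = min (min α β) (1 - α - β)) (hκ : 0 < κ) (hw : 0 < w) (hc₀ : 0 < c₀) (hc₀1 : c₀ ≤ 1)
    (hPD : ∀ h₁ h₂ h₃ : ℝ, slyQ d α β h₁ h₂ h₃ ≤ -κ * (h₁ ^ 2 + h₂ ^ 2 + h₃ ^ 2))
    (hgap : ∀ c ∈ slyPolytope α β, r₀ ≤ dist c (slyCstar α β) →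
      slyRate d α β c.1 c.2.1 c.2.2 ≤ -η)
    (hr₀ : 3 * r₀ ≤ m ^ 2 / 2) (hr₀κ : 12 * (4 + 7 * (d : ℝ)) * (8 * r₀) ≤ κ / 4 * m ^ 4)
    (hr₀κ' : 12 * (4 + 7 * (d : ℝ)) * (27 * r₀) ≤ κ / 2 * m ^ 4)
    (hQ : 3 * ((d : ℝ) + 2) / m ^ 5 * c₀ ^ 2 ≤ κ / 8) (hcube : 48 * c₀ ^ 3 * w ≤ κ / 8 * m ^ 4)
    (hηw : κ * w ^ 2 ≤ η) (hw2 : 2 * w ≤ m ^ 2 / 4) (hμ1 : 1 ≤ μ) (hμ : (μ : ℝ) ≤ n * (m ^ 2 / 2)) :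
    slyRatio0 n d a b ≤
      (Real.exp (slyPrefA α β (α ^ 2) (β ^ 2) / 2) *
          (Real.exp (slyPrefB α β (α ^ 2) (β ^ 2) (α * (1 - α - β)) / 2) / Real.sqrt (slyK3 α β)) ^ d /
          Real.sqrt (slySA d α β * slySC d α β - slySB d α β ^ 2)) *
        ((Real.exp (48 * n * (c₀ * w) ^ 3 / m ^ 4 + 8 * (c₀ * w) / (m ^ 2 / 2) / 2 + 2 / (μ : ℝ)) *
          (Real.exp (180 * n * (2 * w) ^ 3 / m ^ 4 + 19 * (2 * w) / (2 * (m ^ 2 / 2)) + 11 / (6 * (μ : ℝ))) *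
              (1 + 2 / (rexp (π ^ 2 / (slyK3 α β / (2 * n))) - 1)) +
            ((n : ℝ) + 1) * Real.exp (-(n * κ * w ^ 2 / (2 * d)) + 5 * (Real.log n / 2 + 2)) /
              (Real.exp (slyPrefB α β (α ^ 2) (β ^ 2) (α * (1 - α - β)) / 2) / Real.sqrt (slyK3 α β))) ^ d) *
        ((1 + 2 / (rexp (π ^ 2 / (slySC d α β / (2 * n))) - 1)) *
          (1 + 2 / (rexp (π ^ 2 / ((slySA d α β * slySC d α β - slySB d α β ^ 2) / (2 * n * slySC d α β))) - 1)))) +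
      ((n : ℝ) + 1) ^ (d + 2) *
        Real.exp ((5 * d + 2) * (Real.log n / 2 + 2) - n * (κ / 2 * (c₀ * w / 2) ^ 2)) := by
  classical
  have hn0 : 0 < n := hn
  have hnR : (0 : ℝ) < n := by exact_mod_cast hn0
  have hdR : (0 : ℝ) < d := by exact_mod_cast hd
  have hm0 : 0 < m := by rw [hm]; exact lt_min (lt_min hα0 hβ0) (by linarith)
  have eα : (a : ℝ) / n = α := by rw [hα]; field_simp
  have eβ : (b : ℝ) / n = β := by rw [hβ]; field_simp
  obtain ⟨hCge, hAge, hdet, -, -, -⟩ := slyS_bounds hα0 hβ0 hαβ hm hκ hPD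
  set A := slySA d α β with hA
  set B := slySB d α β with hB
  set C := slySC d α β with hC
  have hC0 : 0 < C := by linarith
  have hD0 : 0 < A * C - B ^ 2 := by nlinarith
  -- constants of the near terms
  set KB : ℝ := Real.exp (slyPrefB α β (α ^ 2) (β ^ 2) (α * (1 - α - β)) / 2) / Real.sqrt (slyK3 α β)
    with hKB
  set Const : ℝ := (2 * π * n)⁻¹ * Real.exp (slyPrefA α β (α ^ 2) (β ^ 2) / 2) * KB ^ d with hConst
  set Err : ℝ := Real.exp (48 * n * (c₀ * w) ^ 3 / m ^ 4 + 8 * (c₀ * w) / (m ^ 2 / 2) / 2 + 2 / (μ : ℝ)) *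
    (Real.exp (180 * n * (2 * w) ^ 3 / m ^ 4 + 19 * (2 * w) / (2 * (m ^ 2 / 2)) + 11 / (6 * (μ : ℝ))) *
      (1 + 2 / (rexp (π ^ 2 / (slyK3 α β / (2 * n))) - 1)) +
      ((n : ℝ) + 1) * Real.exp (-(n * κ * w ^ 2 / (2 * d)) + 5 * (Real.log n / 2 + 2)) / KB) ^ d with hErr
  have hκ3 := slyK3_pos hα0 hβ0 hαβ
  have hKB0 : 0 < KB := div_pos (Real.exp_pos _) (Real.sqrt_pos.mpr hκ3)
  have hτ₃1 : 1 ≤ 1 + 2 / (rexp (π ^ 2 / (slyK3 α β / (2 * n))) - 1) := one_le_thetaFactor (by positivity)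
  have hErr0 : 0 ≤ Err := by
    rw [hErr]
    have : 0 ≤ Real.exp (180 * n * (2 * w) ^ 3 / m ^ 4 + 19 * (2 * w) / (2 * (m ^ 2 / 2)) +
        11 / (6 * (μ : ℝ))) * (1 + 2 / (rexp (π ^ 2 / (slyK3 α β / (2 * n))) - 1)) +
      ((n : ℝ) + 1) * Real.exp (-(n * κ * w ^ 2 / (2 * d)) + 5 * (Real.log n / 2 + 2)) / KB := by
      positivity
    positivity
  have hConst0 : 0 ≤ Const := by positivity
  -- split the double sum
  set P := (range (a + 1)) ×ˢ (range (b + 1)) with hP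
  set Near := P.filter (fun p : ℕ × ℕ => |(p.1 : ℝ) / n - α ^ 2| + |(p.2 : ℝ) / n - β ^ 2| ≤ c₀ * w)
    with hNear
  set Far := P.filter (fun p : ℕ × ℕ => ¬ |(p.1 : ℝ) / n - α ^ 2| + |(p.2 : ℝ) / n - β ^ 2| ≤ c₀ * w)
    with hFar
  set F : ℕ × ℕ → ℝ := fun p => slyAcoef n a b p.1 p.2 * slyRho n a b p.1 p.2 ^ d with hF
  have hsplit : slyRatio0 n d a b = ∑ p ∈ Near, F p + ∑ p ∈ Far, F p := by
    unfold slyRatio0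
    rw [← Finset.sum_product (s := range (a + 1)) (t := range (b + 1))
      (f := fun p : ℕ × ℕ => slyAcoef n a b p.1 p.2 * slyRho n a b p.1 p.2 ^ d), ← hP, hNear, hFar,
      Finset.sum_filter_add_sum_filter_not]
  rw [hsplit]
  -- the Gaussian lattice form
  set G : ℕ × ℕ → ℝ := fun p => Real.exp (-((A * ((p.1 : ℝ) - n * α ^ 2) ^ 2 +
      2 * B * ((p.1 : ℝ) - n * α ^ 2) * ((p.2 : ℝ) - n * β ^ 2) + C * ((p.2 : ℝ) - n * β ^ 2) ^ 2) /
      (2 * n))) with hG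
  -- NEAR
  have hnearT : ∀ p ∈ Near, F p ≤ G p * Const * Err := by
    intro p hp
    rw [hNear, mem_filter, hP, mem_product, mem_range, mem_range, Nat.lt_succ_iff, Nat.lt_succ_iff] at hp
    obtain ⟨⟨hga, hhb⟩, hnear⟩ := hp
    have hbN : b + b - p.2 ≤ n := by omega
    have := slyNearTerm_le d hd hn hga hhb hbN habN hα hβ hα0 hβ0 hαβ hm hκ hw hc₀1 hPD hgap hr₀
      hr₀κ hQ hcube hηw hw2 hμ1 hμ hnear
    rw [hF, hG, hConst, hErr]
    simpa [mul_assoc] using this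
  have hNearSum : ∑ p ∈ Near, F p ≤ (∑ p ∈ Near, G p) * (Const * Err) := by
    rw [sum_mul]
    refine sum_le_sum fun p hp => ?_
    rw [← mul_assoc]; exact hnearT p hp
  have hGauss : ∑ p ∈ Near, G p ≤ 2 * π * n / Real.sqrt (A * C - B ^ 2) *
      ((1 + 2 / (rexp (π ^ 2 / (C / (2 * n))) - 1)) *
        (1 + 2 / (rexp (π ^ 2 / ((A * C - B ^ 2) / (2 * n * C))) - 1))) := by
    have h := sum_gauss2_le hC0 hD0 hnR (n * α ^ 2) (n * β ^ 2)
      (Near.image fun p : ℕ × ℕ => ((p.1 : ℤ), (p.2 : ℤ)))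
    rw [sum_image (fun p _ q _ hpq => by
      simp only [Prod.mk.injEq, Nat.cast_inj] at hpq; exact Prod.ext hpq.1 hpq.2)] at h
    simpa [hG] using h
  -- FAR
  have hfarT : ∀ p ∈ Far, F p ≤ ((n : ℝ) + 1) ^ d *
      Real.exp ((5 * d + 2) * (Real.log n / 2 + 2) - n * (κ / 2 * (c₀ * w / 2) ^ 2)) := by
    intro p hp
    rw [hFar, mem_filter, hP, mem_product, mem_range, mem_range, Nat.lt_succ_iff, Nat.lt_succ_iff,
      not_le] at hp
    obtain ⟨⟨hga, hhb⟩, hfar⟩ := hp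
    have hbN : b + b - p.2 ≤ n := by omega
    rw [hF]
    refine slyFarTerm_le d hd hn hga hhb hbN habN (fun e he hne => ?_)
    rw [eα, eβ]
    -- the point `c_e` is in the polytope and far from `c*`
    have hB0 : slyB0 n a b p.1 p.2 ≠ 0 := left_ne_zero_of_mul hne
    have ht : slyT n a b p.1 p.2 e ≠ 0 := right_ne_zero_of_mul hne
    have hgF : p.1 ≤ n - (b + b - p.2) := by
      by_contra hc
      push Not at hc
      apply hB0
      have : ((n - (b + b - p.2)).choose p.1 : ℝ) = 0 := by exact_mod_cast Nat.choose_eq_zero_of_lt hc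
      unfold slyB0; rw [this]; ring
    have hpoly := mem_slyPolytope_of_slyT_ne_zero hn0 hga hhb hbN hgF he ht
    rw [eα, eβ] at hpoly
    have hdist : c₀ * w / 2 ≤ dist ((((p.1 : ℝ) / n), ((p.2 : ℝ) / n), ((e : ℝ) / n)) : ℝ × ℝ × ℝ)
        (slyCstar α β) := by
      rw [slyCstar, Prod.dist_eq, Prod.dist_eq, Real.dist_eq, Real.dist_eq, Real.dist_eq]
      have g1 := le_max_left |(p.1 : ℝ) / n - α ^ 2| (max |(p.2 : ℝ) / n - β ^ 2| |(e : ℝ) / n - α * (1 - α - β)|)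
      have g2 := le_trans (le_max_left |(p.2 : ℝ) / n - β ^ 2| |(e : ℝ) / n - α * (1 - α - β)|)
        (le_max_right |(p.1 : ℝ) / n - α ^ 2| (max |(p.2 : ℝ) / n - β ^ 2| |(e : ℝ) / n - α * (1 - α - β)|))
      linarith
    have hι₀ : 0 < c₀ * w / 2 := by positivity
    have hηι : κ / 2 * (c₀ * w / 2) ^ 2 ≤ η := by
      have : (c₀ * w / 2) ^ 2 ≤ w ^ 2 := by
        apply pow_le_pow_left₀ hι₀.le; nlinarith
      nlinarith
    have hrate := slyRate_far_le d hα0 hβ0 hαβ hm hκ hι₀ hPD hgap hr₀ hr₀κ' hηι hpoly hdist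
    rw [slyRate_eq_zero_add α β _ _ _ d, slyRate_zero_eq_slyFA] at hrate
    linarith
  have hFarSum : ∑ p ∈ Far, F p ≤ ((n : ℝ) + 1) ^ (d + 2) *
      Real.exp ((5 * d + 2) * (Real.log n / 2 + 2) - n * (κ / 2 * (c₀ * w / 2) ^ 2)) := by
    refine le_trans (sum_le_sum hfarT) ?_
    rw [sum_const, nsmul_eq_mul]
    have hcard : (Far.card : ℝ) ≤ ((n : ℝ) + 1) ^ 2 := by
      have h1 : Far.card ≤ P.card := card_filter_le _ _
      have h2 : P.card = (a + 1) * (b + 1) := by rw [hP, card_product, card_range, card_range]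
      have h3 : (a + 1) * (b + 1) ≤ (n + 1) * (n + 1) := Nat.mul_le_mul (by omega) (by omega)
      have : (Far.card : ℝ) ≤ ((n + 1) * (n + 1) : ℕ) := by exact_mod_cast (h1.trans (h2 ▸ h3))
      push_cast at this; nlinarith
    calc (Far.card : ℝ) * (((n : ℝ) + 1) ^ d *
          Real.exp ((5 * d + 2) * (Real.log n / 2 + 2) - n * (κ / 2 * (c₀ * w / 2) ^ 2)))
        ≤ ((n : ℝ) + 1) ^ 2 * (((n : ℝ) + 1) ^ d *
          Real.exp ((5 * d + 2) * (Real.log n / 2 + 2) - n * (κ / 2 * (c₀ * w / 2) ^ 2))) :=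
          mul_le_mul_of_nonneg_right hcard (by positivity)
      _ = _ := by ring
  -- assemble
  have hmain : (∑ p ∈ Near, G p) * (Const * Err) ≤
      (2 * π * n / Real.sqrt (A * C - B ^ 2) *
        ((1 + 2 / (rexp (π ^ 2 / (C / (2 * n))) - 1)) *
          (1 + 2 / (rexp (π ^ 2 / ((A * C - B ^ 2) / (2 * n * C))) - 1)))) * (Const * Err) :=
    mul_le_mul_of_nonneg_right hGauss (by positivity)
  have e1 : (2 * π * n / Real.sqrt (A * C - B ^ 2) *
        ((1 + 2 / (rexp (π ^ 2 / (C / (2 * n))) - 1)) *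
          (1 + 2 / (rexp (π ^ 2 / ((A * C - B ^ 2) / (2 * n * C))) - 1)))) * (Const * Err) =
      (Real.exp (slyPrefA α β (α ^ 2) (β ^ 2) / 2) * KB ^ d / Real.sqrt (A * C - B ^ 2)) *
        (Err * ((1 + 2 / (rexp (π ^ 2 / (C / (2 * n))) - 1)) *
          (1 + 2 / (rexp (π ^ 2 / ((A * C - B ^ 2) / (2 * n * C))) - 1)))) := by
    rw [hConst]
    have hπ : (π : ℝ) ≠ 0 := Real.pi_pos.ne'
    field_simp
  linarith [hNearSum, hFarSum, hmain, e1.le, e1.ge]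

end Explicit

end Literature.Computability.Complexity
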